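import Mathlib
import Summits.Ventures.PercRepro2.CoinKSureAD
import Summits.Ventures.PercRepro2.CoinChainMixLsm
import Summits.Ventures.PercRepro2.CoinChainWorld1
import Summits.Ventures.PercRepro2.CoinChainStar
import Summits.Ventures.PercRepro2.CoinChainMixedCentreChain
import Summits.Ventures.PercRepro2.CoinChainBernstein
import Summits.Ventures.PercRepro2.CoinChainOneMarker
import Summits.Ventures.PercRepro2.CoinChainBernsteinB2

/-!
# The universal PURE chain from the single sign-free inequality (Q*)
(blind cell PercRepro2, night-2 g22; proofs/NIGHT2-DARC.md §62.5, §62.9)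

Pure chain (`ent = ∅`): world-0 law `ν·c` (moments `a0 a1 a2 a12`), world-1 `R`-law
`ν·chainMix ∅ ent' 1 c d` (moments `b0 b1 b2`), world-1 gate `ν·chainMix ∅ ent' 1 c d'` (moments
`g0 g1 g2 g12`), ideal mass `m = ∑_I ν c` and ideal moments `xI, yI`.  The census-true,
nearly tight inequality of §62.9 is, for the `x`-orientation,

  (Q*ₓ)  `(a0 b1 − b0 a1) · (m b2 − b0 yI) ≤ a0 · U111`,   `U111 = T(R¹, G¹)`,

i.e. `T(R¹,G¹) ≥ Λ₁² m_I (p₁ − p₀)(q₁ − q_I)`, and (Q*ᵧ) its mirror.  THEOREM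
(`pureChain_functional_nonneg_of_Qstar`): under the head hypotheses of `chain_world1_nonneg`,
positive world masses and a positive ideal mass, (Q*ₓ) and (Q*ᵧ) imply the pure chain functional
`T(R_ρ, G_ρ) ≥ 0` at EVERY `ρ ∈ [0, 1]` for every pair of nonnegative increasing markers.

Proof: (Q*) + the one-marker bound (`one_marker_bound`, in the global form
`(b0 − g0)(b0 a2 − a0 b2) ≤ a0 (m b2 − b0 yI)`, obtained by splitting the global sums into their
ideal and entered parts) give (Q′) `a0²·U111 + (b0 − g0)·Δ ≥ 0` (`Qprime_of_Qstar_alg`); (Q′)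
with FKG of the world-0 law and the mixed-centre term `U001` gives the Bernstein coefficient
`b₂ ≥ 0` (`b2_of_Qprime`), and `pureChain_functional_nonneg_of_b2` closes.  So the universal
pure chain is REDUCED to (Q*) — or, without the one-marker bound, to (Q′) itself
(`pureChain_functional_nonneg_of_Qprime`): (Q′) is the statement of record (§62.5), (Q*) its
sharpening that holds on every enumerated real head but FAILS in the abstract class (§62.11).
-/

namespace Summit.Ventures.PercRepro2.Coin

open Classical

section QstarMain

variable {V : Type*} [DecidableEq V] {R : Type*} [Field R] [LinearOrder R] [IsStrictOrderedRing R]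

/-- **THE UNIVERSAL PURE CHAIN FROM (Q*).** Notation: `a0 a1 a2 = ∑ ν c, ∑ ν c x, ∑ ν c y` (world 0),
`b0 b1 b2` the same for `ν · chainMix ∅ ent' 1 c d` (world 1), `g0 g1 g2 g12` for the world-1 gate
`ν · chainMix ∅ ent' 1 c d'`, `m xI yI` the entry-free (ideal) mass and moments of `ν c`,
`U111 = b0 b0 g12 − b0 b2 g1 − b0 b1 g2 + b1 b2 g0 = T(R¹, G¹)`.  Under the head hypotheses of
`chain_world1_nonneg`, `d' ≤ d`, positive world masses and a positive ideal mass, the two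
orientations of (Q*), `(a0 b1 − b0 a1)(m b2 − b0 yI) ≤ a0 U111` and
`(a0 b2 − b0 a2)(m b1 − b0 xI) ≤ a0 U111`, imply the pure chain functional at EVERY `ρ ∈ [0, 1]`
for every pair of nonnegative increasing markers. -/
theorem pureChain_functional_nonneg_of_Qstar (U ent' : Finset V) (ν c d d' : Finset V → R)
    (ρ : R) (hρ0 : 0 ≤ ρ) (hρ1 : ρ ≤ 1) (hν0 : ∀ W, 0 ≤ ν W)
    (hν : ∀ s ⊆ U, ∀ t ⊆ U, ν s * ν t ≤ ν (s ∩ t) * ν (s ∪ t))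
    (hc0 : ∀ W, 0 ≤ c W) (hd0 : ∀ W, 0 ≤ d W) (hd'0 : ∀ W, 0 ≤ d' W)
    (hdc : ∀ W, d W ≤ c W) (hd'c : ∀ W, d' W ≤ c W) (hd'd : ∀ W, d' W ≤ d W)
    (hcc : ∀ s t, c s * c t ≤ c (s ∩ t) * c (s ∪ t))
    (hdd : ∀ s t, d s * d t ≤ d (s ∩ t) * d (s ∪ t))
    (hd'd' : ∀ s t, d' s * d' t ≤ d' (s ∩ t) * d' (s ∪ t))
    (hcd : ∀ s t, c s * d t ≤ c (s ∩ t) * d (s ∪ t))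
    (hcd' : ∀ s t, c s * d' t ≤ c (s ∩ t) * d' (s ∪ t))
    (hdd' : ∀ s t, d s * d' t ≤ d (s ∩ t) * d' (s ∪ t))
    (hratio : ∀ s t, s ⊆ t → d s * c t ≤ c s * d t)
    (hratio' : ∀ s t, s ⊆ t → d' s * c t ≤ c s * d' t)
    (x y : Finset V → R) (hx0 : ∀ W, 0 ≤ x W) (hy0 : ∀ W, 0 ≤ y W)
    (hxm : ∀ s t, x s ≤ x (s ∪ t)) (hym : ∀ s t, y s ≤ y (s ∪ t))
    (hpos0 : 0 < ∑ W ∈ U.powerset, ν W * c W)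
    (hpos1 : 0 < ∑ W ∈ U.powerset, ν W * chainMix ∅ ent' 1 c d W)
    (hmI : 0 < ∑ W ∈ U.powerset.filter (fun W => ¬ ∃ r ∈ ent', r ∈ W), ν W * c W)
    (hQx : ((∑ W ∈ U.powerset, ν W * c W) * (∑ W ∈ U.powerset, ν W * chainMix ∅ ent' 1 c d W * x W)
          - (∑ W ∈ U.powerset, ν W * chainMix ∅ ent' 1 c d W) * (∑ W ∈ U.powerset, ν W * c W * x W)) *
        ((∑ W ∈ U.powerset.filter (fun W => ¬ ∃ r ∈ ent', r ∈ W), ν W * c W) *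
            (∑ W ∈ U.powerset, ν W * chainMix ∅ ent' 1 c d W * y W)
          - (∑ W ∈ U.powerset, ν W * chainMix ∅ ent' 1 c d W) *
            (∑ W ∈ U.powerset.filter (fun W => ¬ ∃ r ∈ ent', r ∈ W), ν W * c W * y W)) ≤
      (∑ W ∈ U.powerset, ν W * c W) *
        ((∑ W ∈ U.powerset, ν W * chainMix ∅ ent' 1 c d W) *
            (∑ W ∈ U.powerset, ν W * chainMix ∅ ent' 1 c d W) *
            (∑ W ∈ U.powerset, ν W * chainMix ∅ ent' 1 c d' W * (x W * y W))
          - (∑ W ∈ U.powerset, ν W * chainMix ∅ ent' 1 c d W) *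
            (∑ W ∈ U.powerset, ν W * chainMix ∅ ent' 1 c d W * y W) *
            (∑ W ∈ U.powerset, ν W * chainMix ∅ ent' 1 c d' W * x W)
          - (∑ W ∈ U.powerset, ν W * chainMix ∅ ent' 1 c d W) *
            (∑ W ∈ U.powerset, ν W * chainMix ∅ ent' 1 c d W * x W) *
            (∑ W ∈ U.powerset, ν W * chainMix ∅ ent' 1 c d' W * y W)
          + (∑ W ∈ U.powerset, ν W * chainMix ∅ ent' 1 c d W * x W) *
            (∑ W ∈ U.powerset, ν W * chainMix ∅ ent' 1 c d W * y W) *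
            (∑ W ∈ U.powerset, ν W * chainMix ∅ ent' 1 c d' W)))
    (hQy : ((∑ W ∈ U.powerset, ν W * c W) * (∑ W ∈ U.powerset, ν W * chainMix ∅ ent' 1 c d W * y W)
          - (∑ W ∈ U.powerset, ν W * chainMix ∅ ent' 1 c d W) * (∑ W ∈ U.powerset, ν W * c W * y W)) *
        ((∑ W ∈ U.powerset.filter (fun W => ¬ ∃ r ∈ ent', r ∈ W), ν W * c W) *
            (∑ W ∈ U.powerset, ν W * chainMix ∅ ent' 1 c d W * x W)
          - (∑ W ∈ U.powerset, ν W * chainMix ∅ ent' 1 c d W) *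
            (∑ W ∈ U.powerset.filter (fun W => ¬ ∃ r ∈ ent', r ∈ W), ν W * c W * x W)) ≤
      (∑ W ∈ U.powerset, ν W * c W) *
        ((∑ W ∈ U.powerset, ν W * chainMix ∅ ent' 1 c d W) *
            (∑ W ∈ U.powerset, ν W * chainMix ∅ ent' 1 c d W) *
            (∑ W ∈ U.powerset, ν W * chainMix ∅ ent' 1 c d' W * (x W * y W))
          - (∑ W ∈ U.powerset, ν W * chainMix ∅ ent' 1 c d W) *
            (∑ W ∈ U.powerset, ν W * chainMix ∅ ent' 1 c d W * y W) *
            (∑ W ∈ U.powerset, ν W * chainMix ∅ ent' 1 c d' W * x W)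
          - (∑ W ∈ U.powerset, ν W * chainMix ∅ ent' 1 c d W) *
            (∑ W ∈ U.powerset, ν W * chainMix ∅ ent' 1 c d W * x W) *
            (∑ W ∈ U.powerset, ν W * chainMix ∅ ent' 1 c d' W * y W)
          + (∑ W ∈ U.powerset, ν W * chainMix ∅ ent' 1 c d W * x W) *
            (∑ W ∈ U.powerset, ν W * chainMix ∅ ent' 1 c d W * y W) *
            (∑ W ∈ U.powerset, ν W * chainMix ∅ ent' 1 c d' W))) :
    0 ≤ (∑ W ∈ U.powerset, ν W * chainMix ∅ ent' ρ c d W) ^ 2 *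
          (∑ W ∈ U.powerset, ν W * chainMix ∅ ent' ρ c d' W * (x W * y W))
        - (∑ W ∈ U.powerset, ν W * chainMix ∅ ent' ρ c d W) *
          (∑ W ∈ U.powerset, ν W * chainMix ∅ ent' ρ c d W * x W) *
          (∑ W ∈ U.powerset, ν W * chainMix ∅ ent' ρ c d' W * y W)
        - (∑ W ∈ U.powerset, ν W * chainMix ∅ ent' ρ c d W) *
          (∑ W ∈ U.powerset, ν W * chainMix ∅ ent' ρ c d W * y W) *
          (∑ W ∈ U.powerset, ν W * chainMix ∅ ent' ρ c d' W * x W)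
        + (∑ W ∈ U.powerset, ν W * chainMix ∅ ent' ρ c d W * x W) *
          (∑ W ∈ U.powerset, ν W * chainMix ∅ ent' ρ c d W * y W) *
          (∑ W ∈ U.powerset, ν W * chainMix ∅ ent' ρ c d' W) := by
  -- names for the moments
  set a0 := ∑ W ∈ U.powerset, ν W * c W with ha0
  set a1 := ∑ W ∈ U.powerset, ν W * c W * x W with ha1
  set a2 := ∑ W ∈ U.powerset, ν W * c W * y W with ha2
  set a12 := ∑ W ∈ U.powerset, ν W * c W * (x W * y W) with ha12
  set b0 := ∑ W ∈ U.powerset, ν W * chainMix ∅ ent' 1 c d W with hb0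
  set b1 := ∑ W ∈ U.powerset, ν W * chainMix ∅ ent' 1 c d W * x W with hb1
  set b2 := ∑ W ∈ U.powerset, ν W * chainMix ∅ ent' 1 c d W * y W with hb2'
  set g0 := ∑ W ∈ U.powerset, ν W * chainMix ∅ ent' 1 c d' W with hg0
  set g1 := ∑ W ∈ U.powerset, ν W * chainMix ∅ ent' 1 c d' W * x W with hg1
  set g2 := ∑ W ∈ U.powerset, ν W * chainMix ∅ ent' 1 c d' W * y W with hg2
  set g12 := ∑ W ∈ U.powerset, ν W * chainMix ∅ ent' 1 c d' W * (x W * y W) with hg12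
  set m := ∑ W ∈ U.powerset.filter (fun W => ¬ ∃ r ∈ ent', r ∈ W), ν W * c W with hm
  set xI := ∑ W ∈ U.powerset.filter (fun W => ¬ ∃ r ∈ ent', r ∈ W), ν W * c W * x W with hxI
  set yI := ∑ W ∈ U.powerset.filter (fun W => ¬ ∃ r ∈ ent', r ∈ W), ν W * c W * y W with hyI
  -- the entered parts of the three laws
  set M := ∑ W ∈ U.powerset.filter (fun W => ∃ r ∈ ent', r ∈ W), ν W * c W with hM
  set xM := ∑ W ∈ U.powerset.filter (fun W => ∃ r ∈ ent', r ∈ W), ν W * c W * x W with hxM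
  set yM := ∑ W ∈ U.powerset.filter (fun W => ∃ r ∈ ent', r ∈ W), ν W * c W * y W with hyM
  set r := ∑ W ∈ U.powerset.filter (fun W => ∃ r ∈ ent', r ∈ W), ν W * d W with hr
  set xr := ∑ W ∈ U.powerset.filter (fun W => ∃ r ∈ ent', r ∈ W), ν W * d W * x W with hxr
  set yr := ∑ W ∈ U.powerset.filter (fun W => ∃ r ∈ ent', r ∈ W), ν W * d W * y W with hyr
  set g := ∑ W ∈ U.powerset.filter (fun W => ∃ r ∈ ent', r ∈ W), ν W * d' W with hg
  -- splitting the global sums into ideal + entered parts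
  have hsplit : ∀ f : Finset V → R, (∑ W ∈ U.powerset, f W) =
      (∑ W ∈ U.powerset.filter (fun W => ¬ ∃ r ∈ ent', r ∈ W), f W) +
        (∑ W ∈ U.powerset.filter (fun W => ∃ r ∈ ent', r ∈ W), f W) := by
    intro f; rw [add_comm, Finset.sum_filter_add_sum_filter_not]
  have hmeet : ∀ W : Finset V, (∃ r ∈ ent', r ∈ W) → chainMix ∅ ent' 1 c d W = d W := by
    intro W hW
    apply chainMix_one_of_meet
    obtain ⟨r', hr', hrW⟩ := hW; exact ⟨r', by simpa using hr', hrW⟩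
  have hmeet' : ∀ W : Finset V, (∃ r ∈ ent', r ∈ W) → chainMix ∅ ent' 1 c d' W = d' W := by
    intro W hW
    apply chainMix_one_of_meet
    obtain ⟨r', hr', hrW⟩ := hW; exact ⟨r', by simpa using hr', hrW⟩
  have hnomeet : ∀ W : Finset V, (¬ ∃ r ∈ ent', r ∈ W) → chainMix ∅ ent' 1 c d W = c W := by
    intro W hW
    apply chainMix_of_not_meet
    rintro ⟨r', hr', hrW⟩; exact hW ⟨r', by simpa using hr', hrW⟩
  have hnomeet' : ∀ W : Finset V, (¬ ∃ r ∈ ent', r ∈ W) → chainMix ∅ ent' 1 c d' W = c W := by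
    intro W hW
    apply chainMix_of_not_meet
    rintro ⟨r', hr', hrW⟩; exact hW ⟨r', by simpa using hr', hrW⟩
  have ea0 : a0 = m + M := hsplit _
  have ea1 : a1 = xI + xM := hsplit _
  have ea2 : a2 = yI + yM := hsplit _
  have eb0 : b0 = m + r := by
    rw [hb0, hsplit]
    congr 1
    · exact Finset.sum_congr rfl fun W hW => by rw [hnomeet W (Finset.mem_filter.1 hW).2]
    · exact Finset.sum_congr rfl fun W hW => by rw [hmeet W (Finset.mem_filter.1 hW).2]
  have eb1 : b1 = xI + xr := by
    rw [hb1, hsplit]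
    congr 1
    · exact Finset.sum_congr rfl fun W hW => by rw [hnomeet W (Finset.mem_filter.1 hW).2]
    · exact Finset.sum_congr rfl fun W hW => by rw [hmeet W (Finset.mem_filter.1 hW).2]
  have eb2 : b2 = yI + yr := by
    rw [hb2', hsplit]
    congr 1
    · exact Finset.sum_congr rfl fun W hW => by rw [hnomeet W (Finset.mem_filter.1 hW).2]
    · exact Finset.sum_congr rfl fun W hW => by rw [hmeet W (Finset.mem_filter.1 hW).2]
  have eg0 : g0 = m + g := by
    rw [hg0, hsplit]
    congr 1
    · exact Finset.sum_congr rfl fun W hW => by rw [hnomeet' W (Finset.mem_filter.1 hW).2]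
    · exact Finset.sum_congr rfl fun W hW => by rw [hmeet' W (Finset.mem_filter.1 hW).2]
  -- the one-marker bounds in the global form
  have hOMy_raw := one_marker_bound U ent' ν c d d' y hν0 hν hc0 hd0 hd'0 hd'd hdd hcd hy0 hym
  have hOMx_raw := one_marker_bound U ent' ν c d d' x hν0 hν hc0 hd0 hd'0 hd'd hdd hcd hx0 hxm
  have hOMy : (b0 - g0) * (b0 * a2 - a0 * b2) ≤ a0 * (m * b2 - b0 * yI) := by
    rw [ea0, ea2, eb0, eb2, eg0]
    refine le_of_mul_le_mul_left ?_ hmI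
    calc m * ((m + r - (m + g)) * ((m + r) * (yI + yM) - (m + M) * (yI + yr)))
        = (r - g) * (m * (yI * (r - M) + yM * (m + r) - yr * (m + M))) := by ring
      _ ≤ m * (m + M) * (yr * m - yI * r) := hOMy_raw
      _ = m * ((m + M) * (m * (yI + yr) - (m + r) * yI)) := by ring
  have hOMx : (b0 - g0) * (b0 * a1 - a0 * b1) ≤ a0 * (m * b1 - b0 * xI) := by
    rw [ea0, ea1, eb0, eb1, eg0]
    refine le_of_mul_le_mul_left ?_ hmI
    calc m * ((m + r - (m + g)) * ((m + r) * (xI + xM) - (m + M) * (xI + xr)))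
        = (r - g) * (m * (xI * (r - M) + xM * (m + r) - xr * (m + M))) := by ring
      _ ≤ m * (m + M) * (xr * m - xI * r) := hOMx_raw
      _ = m * ((m + M) * (m * (xI + xr) - (m + r) * xI)) := by ring
  -- the kernel mixed-centre terms
  have hU111 := chain_world1_mixed_nonneg U ∅ ent' ν c d d' 1 1 zero_le_one le_rfl zero_le_one
    le_rfl hν0 hν hc0 hd0 hd'0 hdc hd'c hcc hdd hd'd' hcd hcd' hdd' hratio hratio' x y hx0 hy0 hxm hym
  have hU001 := chain_world1_mixed_nonneg U ∅ ent' ν c d d' 0 0 le_rfl zero_le_one le_rfl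
    zero_le_one hν0 hν hc0 hd0 hd'0 hdc hd'c hcc hdd hd'd' hcd hcd' hdd' hratio hratio' x y hx0 hy0 hxm hym
  simp only [chainMix_zero_empty] at hU001
  have hP : 0 ≤ b0 - g0 := by
    rw [hb0, hg0]
    have : g0 ≤ b0 := Finset.sum_le_sum fun W _ =>
      mul_le_mul_of_nonneg_left (chainMix_one_mono ∅ ent' hd'd W) (hν0 W)
    linarith
  -- FKG of the world-0 law
  have hL₀0 : ∀ W, 0 ≤ ν W * c W := fun W => mul_nonneg (hν0 W) (hc0 W)
  have hD : a1 * a2 ≤ a0 * a12 := by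
    refine ad_pointwise U (fun W => ν W * c W * x W) (fun W => ν W * c W * y W)
      (fun W => ν W * c W) (fun W => ν W * c W * (x W * y W))
      (fun W => mul_nonneg (hL₀0 W) (hx0 W)) (fun W => mul_nonneg (hL₀0 W) (hy0 W)) hL₀0
      (fun W => mul_nonneg (hL₀0 W) (mul_nonneg (hx0 W) (hy0 W))) ?_
    intro s hs t ht
    have e1 : ν s * ν t ≤ ν (s ∩ t) * ν (s ∪ t) := hν s hs t ht
    have e2 := hcc s t
    have e3 := hxm s t
    have e4 : y t ≤ y (s ∪ t) := by rw [Finset.union_comm]; exact hym t s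
    calc ν s * c s * x s * (ν t * c t * y t)
        = (ν s * ν t) * (c s * c t) * (x s * y t) := by ring
      _ ≤ (ν (s ∩ t) * ν (s ∪ t)) * (c (s ∩ t) * c (s ∪ t)) * (x (s ∪ t) * y (s ∪ t)) := by
          apply mul_le_mul (mul_le_mul e1 e2 (mul_nonneg (hc0 _) (hc0 _))
            (mul_nonneg (hν0 _) (hν0 _)))
            (mul_le_mul e3 e4 (hy0 _) (hx0 _)) (mul_nonneg (hx0 _) (hy0 _))
            (mul_nonneg (mul_nonneg (hν0 _) (hν0 _)) (mul_nonneg (hc0 _) (hc0 _)))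
      _ = ν (s ∩ t) * c (s ∩ t) * (ν (s ∪ t) * c (s ∪ t) * (x (s ∪ t) * y (s ∪ t))) := by ring
  -- (Q*) ⟹ (Q′) ⟹ b₂ ≥ 0
  have hQ := Qprime_of_Qstar_alg a0 a1 a2 b0 b1 b2 g0 m xI yI
    (b0 * b0 * g12 - b0 * b2 * g1 - b0 * b1 * g2 + b1 * b2 * g0) hpos0.le hU111 hP hQx hQy hOMx hOMy
  have hb2 := b2_of_Qprime a0 a1 a2 a12 b0 b1 b2 g0 g1 g2 g12 hpos0 hpos1 (by linarith) hU001 hQ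
  exact pureChain_functional_nonneg_of_b2 U ent' ν c d d' ρ hρ0 hρ1 hν0 hν hc0 hd0 hd'0 hdc hd'c
    hcc hdd hd'd' hcd hcd' hdd' hratio hratio' x y hx0 hy0 hxm hym hb2

end QstarMain

section QprimeMain

variable {V : Type*} [DecidableEq V] {R : Type*} [Field R] [LinearOrder R] [IsStrictOrderedRing R]

/-- **THE UNIVERSAL PURE CHAIN FROM (Q′).** With the moments as above and
`Δ = (b0 a1 − a0 b1)(b0 a2 − a0 b2)`, `P₀ = b0 − g0` (the world-1 pivotal mass): under the head
hypotheses and positive world masses, (Q′) `a0² · U111 + P₀ · Δ ≥ 0` implies the pure chain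
functional at EVERY `ρ ∈ [0, 1]` (general markers) — (Q′) is the `ρ²(1−ρ)` coefficient of §58's
(★) without its two manifestly nonnegative terms; the census sees it with ratio ≤ 0.47 on real
heads and ≤ 0.26 on the abstract class. -/
theorem pureChain_functional_nonneg_of_Qprime (U ent' : Finset V) (ν c d d' : Finset V → R)
    (ρ : R) (hρ0 : 0 ≤ ρ) (hρ1 : ρ ≤ 1) (hν0 : ∀ W, 0 ≤ ν W)
    (hν : ∀ s ⊆ U, ∀ t ⊆ U, ν s * ν t ≤ ν (s ∩ t) * ν (s ∪ t))
    (hc0 : ∀ W, 0 ≤ c W) (hd0 : ∀ W, 0 ≤ d W) (hd'0 : ∀ W, 0 ≤ d' W)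
    (hdc : ∀ W, d W ≤ c W) (hd'c : ∀ W, d' W ≤ c W)
    (hcc : ∀ s t, c s * c t ≤ c (s ∩ t) * c (s ∪ t))
    (hdd : ∀ s t, d s * d t ≤ d (s ∩ t) * d (s ∪ t))
    (hd'd' : ∀ s t, d' s * d' t ≤ d' (s ∩ t) * d' (s ∪ t))
    (hcd : ∀ s t, c s * d t ≤ c (s ∩ t) * d (s ∪ t))
    (hcd' : ∀ s t, c s * d' t ≤ c (s ∩ t) * d' (s ∪ t))
    (hdd' : ∀ s t, d s * d' t ≤ d (s ∩ t) * d' (s ∪ t))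
    (hratio : ∀ s t, s ⊆ t → d s * c t ≤ c s * d t)
    (hratio' : ∀ s t, s ⊆ t → d' s * c t ≤ c s * d' t)
    (x y : Finset V → R) (hx0 : ∀ W, 0 ≤ x W) (hy0 : ∀ W, 0 ≤ y W)
    (hxm : ∀ s t, x s ≤ x (s ∪ t)) (hym : ∀ s t, y s ≤ y (s ∪ t))
    (hpos0 : 0 < ∑ W ∈ U.powerset, ν W * c W)
    (hpos1 : 0 < ∑ W ∈ U.powerset, ν W * chainMix ∅ ent' 1 c d W)
    (hQ : 0 ≤ (∑ W ∈ U.powerset, ν W * c W) ^ 2 *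
          ((∑ W ∈ U.powerset, ν W * chainMix ∅ ent' 1 c d W) *
            (∑ W ∈ U.powerset, ν W * chainMix ∅ ent' 1 c d W) *
            (∑ W ∈ U.powerset, ν W * chainMix ∅ ent' 1 c d' W * (x W * y W))
          - (∑ W ∈ U.powerset, ν W * chainMix ∅ ent' 1 c d W) *
            (∑ W ∈ U.powerset, ν W * chainMix ∅ ent' 1 c d W * y W) *
            (∑ W ∈ U.powerset, ν W * chainMix ∅ ent' 1 c d' W * x W)
          - (∑ W ∈ U.powerset, ν W * chainMix ∅ ent' 1 c d W) *
            (∑ W ∈ U.powerset, ν W * chainMix ∅ ent' 1 c d W * x W) *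
            (∑ W ∈ U.powerset, ν W * chainMix ∅ ent' 1 c d' W * y W)
          + (∑ W ∈ U.powerset, ν W * chainMix ∅ ent' 1 c d W * x W) *
            (∑ W ∈ U.powerset, ν W * chainMix ∅ ent' 1 c d W * y W) *
            (∑ W ∈ U.powerset, ν W * chainMix ∅ ent' 1 c d' W))
        + ((∑ W ∈ U.powerset, ν W * chainMix ∅ ent' 1 c d W) -
            (∑ W ∈ U.powerset, ν W * chainMix ∅ ent' 1 c d' W)) *
          (((∑ W ∈ U.powerset, ν W * chainMix ∅ ent' 1 c d W) * (∑ W ∈ U.powerset, ν W * c W * x W)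
              - (∑ W ∈ U.powerset, ν W * c W) * (∑ W ∈ U.powerset, ν W * chainMix ∅ ent' 1 c d W * x W)) *
            ((∑ W ∈ U.powerset, ν W * chainMix ∅ ent' 1 c d W) * (∑ W ∈ U.powerset, ν W * c W * y W)
              - (∑ W ∈ U.powerset, ν W * c W) * (∑ W ∈ U.powerset, ν W * chainMix ∅ ent' 1 c d W * y W)))) :
    0 ≤ (∑ W ∈ U.powerset, ν W * chainMix ∅ ent' ρ c d W) ^ 2 *
          (∑ W ∈ U.powerset, ν W * chainMix ∅ ent' ρ c d' W * (x W * y W))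
        - (∑ W ∈ U.powerset, ν W * chainMix ∅ ent' ρ c d W) *
          (∑ W ∈ U.powerset, ν W * chainMix ∅ ent' ρ c d W * x W) *
          (∑ W ∈ U.powerset, ν W * chainMix ∅ ent' ρ c d' W * y W)
        - (∑ W ∈ U.powerset, ν W * chainMix ∅ ent' ρ c d W) *
          (∑ W ∈ U.powerset, ν W * chainMix ∅ ent' ρ c d W * y W) *
          (∑ W ∈ U.powerset, ν W * chainMix ∅ ent' ρ c d' W * x W)
        + (∑ W ∈ U.powerset, ν W * chainMix ∅ ent' ρ c d W * x W) *
          (∑ W ∈ U.powerset, ν W * chainMix ∅ ent' ρ c d W * y W) *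
          (∑ W ∈ U.powerset, ν W * chainMix ∅ ent' ρ c d' W) := by
  have hU001 := chain_world1_mixed_nonneg U ∅ ent' ν c d d' 0 0 le_rfl zero_le_one le_rfl
    zero_le_one hν0 hν hc0 hd0 hd'0 hdc hd'c hcc hdd hd'd' hcd hcd' hdd' hratio hratio' x y hx0 hy0 hxm hym
  simp only [chainMix_zero_empty] at hU001
  have hL₀0 : ∀ W, 0 ≤ ν W * c W := fun W => mul_nonneg (hν0 W) (hc0 W)
  have hD : (∑ W ∈ U.powerset, ν W * c W * x W) * (∑ W ∈ U.powerset, ν W * c W * y W) ≤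
      (∑ W ∈ U.powerset, ν W * c W) * (∑ W ∈ U.powerset, ν W * c W * (x W * y W)) := by
    refine ad_pointwise U (fun W => ν W * c W * x W) (fun W => ν W * c W * y W)
      (fun W => ν W * c W) (fun W => ν W * c W * (x W * y W))
      (fun W => mul_nonneg (hL₀0 W) (hx0 W)) (fun W => mul_nonneg (hL₀0 W) (hy0 W)) hL₀0
      (fun W => mul_nonneg (hL₀0 W) (mul_nonneg (hx0 W) (hy0 W))) ?_
    intro s hs t ht
    have e1 : ν s * ν t ≤ ν (s ∩ t) * ν (s ∪ t) := hν s hs t ht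
    have e2 := hcc s t
    have e3 := hxm s t
    have e4 : y t ≤ y (s ∪ t) := by rw [Finset.union_comm]; exact hym t s
    calc ν s * c s * x s * (ν t * c t * y t)
        = (ν s * ν t) * (c s * c t) * (x s * y t) := by ring
      _ ≤ (ν (s ∩ t) * ν (s ∪ t)) * (c (s ∩ t) * c (s ∪ t)) * (x (s ∪ t) * y (s ∪ t)) := by
          apply mul_le_mul (mul_le_mul e1 e2 (mul_nonneg (hc0 _) (hc0 _))
            (mul_nonneg (hν0 _) (hν0 _)))
            (mul_le_mul e3 e4 (hy0 _) (hx0 _)) (mul_nonneg (hx0 _) (hy0 _))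
            (mul_nonneg (mul_nonneg (hν0 _) (hν0 _)) (mul_nonneg (hc0 _) (hc0 _)))
      _ = ν (s ∩ t) * c (s ∩ t) * (ν (s ∪ t) * c (s ∪ t) * (x (s ∪ t) * y (s ∪ t))) := by ring
  have hb2 := b2_of_Qprime _ _ _ _ _ _ _ _ _ _ _ hpos0 hpos1 (by linarith) hU001 hQ
  exact pureChain_functional_nonneg_of_b2 U ent' ν c d d' ρ hρ0 hρ1 hν0 hν hc0 hd0 hd'0 hdc hd'c
    hcc hdd hd'd' hcd hcd' hdd' hratio hratio' x y hx0 hy0 hxm hym hb2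

end QprimeMain

end Summit.Ventures.PercRepro2.Coin
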